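import Mathlib
import HarnessLib
import Summits.Ventures.LatticeQCDFlow.Exactness.SphereLuscherRecursionVariance
import Summits.Ventures.LatticeQCDFlow.Exactness.SphereLuscherGeneratorLocality
import Summits.Ventures.LatticeQCDFlow.Exactness.SphereLuscherSeriesCoefficientCount

/-!
# Volume-independent `L²(π̄)` bounds on the local terms of Lüscher's flow-action series for the lattice CP(N−1)/O(N) action

HONEST FRAMING: exact (Metropolis-corrected) sampling algorithms for lattice gauge theory;
figures of merit are autocorrelation/cost numbers at stated couplings and volumes; no
continuum-physics claim.

Venture `LatticeQCDFlow` (cell pub-lqcd), topic `Exactness`; FANOUT row 7 (`s0-cpn-null`: the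
S0-D1 rung — 2D CP⁹, Lüscher's LO trivializing map inside HMC, Engel–Schaefer 2011).  NEW WORK of
the cell over Mathlib and the tree's `Exactness/SphereLuscherRecursionVariance.lean` (this leg:
`(d−1)²·Var(X) ≤ Var(R)` along the recursion, the Cauchy–Schwarz–Bernstein source bound, Bernstein
under `π̄`), `Exactness/SphereLuscherSeriesLocality(ES).lean` (GEN-9: the local recursion
`X_n⁽ᵏ⁾ = localTerm`, `X_n⁽ᵏ⁾ ∈ polySD (2(k+1)) (nball (couplingNbhd U) (k+1) n)`, `esLocalAction`,
`esPart`), `Exactness/SphereLuscherGeneratorLocality.lean` (`siteGrad_eq_zero_of_not_mem'`: `∂̃_kX = 0`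
off the support of `X`), `Exactness/SphereLuscherSeriesCoefficientCount.lean` (`ncard_nball_le`: at most
`(Δ+1)^r` sites in a coupling ball of radius `r`), `Exactness/SphereLOFlowAction.lean` (E–S eq. (13):
`∂̃_k S = −2κ P_{x_k} J_k`) and `Exactness/SphereGeodesicKick.lean` (`norm_tangentKick_sq`); nothing
is cited as a fact.  Printed counterpart, NAMED ONLY: M. Lüscher, Commun. Math. Phys. 293 (2010)
899, §3.3 eqs. (3.9)–(3.12) and §4.4–§4.5 (each order of the flow action is obtained from the
previous one by inverting the Laplacian on the source `−Σ⟨∂S, ∂S̃⁽ᵏ⁾⟩`; the terms are local, with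
finitely many coefficients per site uniformly in the lattice size); Engel–Schaefer, Comput. Phys.
Commun. 182 (2011) 2107, §3 eqs. (13)–(16).  The tree so far types existence, uniqueness, locality
(footprint `k+1`) and the coefficient COUNT of the series (`SphereLuscherSeriesCoefficientCount`);
GEN-9's write-up lists "bounds on the coefficients / norms of `S̃⁽ᵏ⁾`" as NOT CLAIMED.  This file
gives the first NORM bounds: every local term of every order has an `L²(π̄)` fluctuation bounded by
the order, `d = dim E`, the coordination number and the coupling size ONLY — not by `|Λ|` (cell
theory question "how must the map scale with VOLUME": at fixed order, per site, not at all).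

## Setting

`E` finite-dimensional real inner product space, `d = dim E ≥ 2` (CP(N−1): `d = 2N`); `Λ` finite
nonempty; `π̄ = ⊗_Λ σ̄` the uniform probability measure on `Ω = S(E)^Λ` (`σ̄ = uniformSphere volume`);
`Var(F) = ∫(F − ∫F dπ̄)² dπ̄`; E–S couplings `U` (no self-coupling, adjoint pairs) of weight
`Σ_m ‖U_{km}‖ ≤ υ` at every site and with at most `Δ` partners per site
(`(couplingNbhd U m).ncard ≤ Δ`); `S = esAction κ S₀ U = −κ Σ_n⟪x_n, J_n⟫ + S₀`;
`X_n⁽ᵏ⁾ = localTerm h2 (esLocalAction …) k n`, the order-`k` local term anchored at `n` (GEN-9).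

## Content

* §1 `norm_localField_le` (`‖J_k‖ ≤ υ` on `Ω`), `norm_tangentKick_le` (`‖P_uJ‖ ≤ ‖J‖`),
  **`norm_siteGrad_esAction_le`** — THE FORCE BOUND `‖∂̃_k S‖ ≤ 2|κ|υ` on `Ω`, every site, every `Λ`.
* §2 `localVarConst d Δ k` — the explicit constants `A₀ = (d−1)⁻²`,
  `A_{k+1} = A_k · 4(Δ+1)^{k+1}·2(k+1)(2(k+1)+d−2)/(d−1)²` (`localVarConst_nonneg`);
  `esLocalAction_part/deg/N`, `localTerm_mem_es`, `continuous_localTerm_sphereConfig`,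
  `siteGrad_localTerm_eq_zero`;
  **`variance_localTerm_zero_le`** (`Var(X_n⁽⁰⁾) ≤ (κυ)²/(d−1)²`: the part `s_n = −κ⟪x_n,J_n⟫ + S₀/|Λ|`
  fluctuates by at most `|κ|υ`); **`variance_localTerm_succ_le`** (ONE STEP OF THE CHAIN:
  `Var(X_n⁽ᵏ⁺¹⁾) ≤ 4(κυ)²(Δ+1)^{k+1}·2(k+1)(2(k+1)+d−2)/(d−1)² · Var(X_n⁽ᵏ⁾)` — stability of the
  Poisson step, Cauchy–Schwarz over the `≤ (Δ+1)^{k+1}` sites of the footprint, the force bound, and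
  Bernstein at degree `2(k+1)`); **`variance_localTerm_le`** — FOR EVERY ORDER `k`, ANCHOR `n` AND
  FINITE LATTICE `Λ`: `Var_π̄(X_n⁽ᵏ⁾) ≤ (κυ)^{2(k+1)}·A_k(d, Δ)` — THE `L²(π̄)` FLUCTUATION OF EACH
  LOCAL TERM OF THE PERTURBATIVE TRIVIALIZING FLOW ACTION IS BOUNDED INDEPENDENTLY OF THE VOLUME;
  **`dirichlet_localTerm_le`** — the generator form
  `Σ_m∫‖∂̃_m X_n⁽ᵏ⁾‖²dπ̄ ≤ 2(k+1)(2(k+1)+d−2)·(κυ)^{2(k+1)}·A_k` (the `L²(π̄)` kinetic energy of the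
  order-`k` local GENERATOR `−∂̃X_n⁽ᵏ⁾`, the vector field of the perturbative map, per anchor).

Sequel `Exactness/SphereLuscherSeriesExtensive.lean`: `Var_π̄(S̃⁽ᵏ⁾) ≤ |Λ|·C_k` for every `C²` series.

NOT CLAIMED: sharpness of `A_k` (it grows super-exponentially in `k` — nothing is said about
convergence of `Σ t^k S̃⁽ᵏ⁾` or any `t > 0`); sup-norm / coefficient-wise bounds; bounds for the
interacting measure `e^{−S}dπ`; anything about autocorrelations or the rung's numbers.
-/

noncomputable section

namespace Summit.Ventures.LatticeQCDFlow.Exactness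

open Function Set Metric MeasureTheory NormedSpace InnerProductSpace
open scoped RealInnerProductSpace

variable {Λ : Type*} {E : Type*} [NormedAddCommGroup E] [InnerProductSpace ℝ E]
  [FiniteDimensional ℝ E] [MeasurableSpace E] [BorelSpace E]

/-! ## §1 The force bound -/

section Force

variable [Fintype Λ] [DecidableEq Λ] {U : Λ → Λ → (E →L[ℝ] E)}

omit [FiniteDimensional ℝ E] [MeasurableSpace E] [BorelSpace E] [DecidableEq Λ] in
/-- **`‖J_k(x)‖ ≤ υ` on the product of unit spheres**, for couplings of weight `Σ_m ‖U_{km}‖ ≤ υ`. -/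
theorem norm_localField_le {υ : ℝ} (hυ : ∀ k, ∑ m, ‖U k m‖ ≤ υ)
    {x : Λ → E} (hx : ∀ n, ‖x n‖ = 1) (k : Λ) : ‖localField U k x‖ ≤ υ := by
  unfold localField
  calc ‖∑ m, U k m (x m)‖ ≤ ∑ m, ‖U k m (x m)‖ := norm_sum_le _ _
    _ ≤ ∑ m, ‖U k m‖ := Finset.sum_le_sum fun m _ => by
        calc ‖U k m (x m)‖ ≤ ‖U k m‖ * ‖x m‖ := (U k m).le_opNorm _
          _ = ‖U k m‖ := by rw [hx m, mul_one]
    _ ≤ υ := hυ k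

omit [FiniteDimensional ℝ E] [MeasurableSpace E] [BorelSpace E] [Fintype Λ] [DecidableEq Λ] in
/-- The tangential part is shorter than the vector: `‖P_u J‖ ≤ ‖J‖` for `‖u‖ = 1`. -/
theorem norm_tangentKick_le {u : E} (hu : ‖u‖ = 1) (J : E) : ‖tangentKick J u‖ ≤ ‖J‖ := by
  have h : ‖tangentKick J u‖ ^ 2 ≤ ‖J‖ ^ 2 := by
    rw [norm_tangentKick_sq J hu]
    nlinarith [sq_nonneg ⟪J, u⟫]
  simpa only [abs_norm] using sq_le_sq.1 h

omit [MeasurableSpace E] [BorelSpace E] in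
/-- **`‖∂̃_k S‖ ≤ 2|κ|υ` on the product of unit spheres** (E–S eq. (13): `∂̃_k S = −2κ P_{x_k}J_k`). -/
theorem norm_siteGrad_esAction_le (hU0 : ∀ n, U n n = 0)
    (hUadj : ∀ m n (v w : E), ⟪U m n v, w⟫ = ⟪v, U n m w⟫) (κ S₀ : ℝ) {υ : ℝ}
    (hυ : ∀ k, ∑ m, ‖U k m‖ ≤ υ) {x : Λ → E} (hx : ∀ n, ‖x n‖ = 1) (k : Λ) :
    ‖siteGrad k (esAction κ S₀ U) x‖ ≤ 2 * |κ| * υ := by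
  rw [siteGrad_esAction hU0 hUadj κ S₀ (hx k), norm_smul, Real.norm_eq_abs, abs_neg, abs_mul,
    abs_two]
  calc 2 * |κ| * ‖tangentKick (localField U k x) (x k)‖ ≤ 2 * |κ| * ‖localField U k x‖ := by
        gcongr; exact norm_tangentKick_le (hx k) _
    _ ≤ 2 * |κ| * υ := by gcongr; exact norm_localField_le hυ hx k

end Force

/-! ## §2 The recursive, volume-independent variance bound for the local terms -/

section Recursion

/-- **The volume-independent constants `A_k(d, Δ)`** of the variance bounds: `A₀ = (d−1)⁻²`,
`A_{k+1} = A_k · 4(Δ+1)^{k+1} · 2(k+1)·(2(k+1)+d−2) / (d−1)²` — they depend on the order `k`, the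
target dimension `d` and the coordination bound `Δ` only. -/
def localVarConst (d Δ : ℕ) : ℕ → ℝ
  | 0 => (((d : ℝ) - 1) ^ 2)⁻¹
  | k + 1 => localVarConst d Δ k *
      (4 * ((Δ : ℝ) + 1) ^ (k + 1) * ((2 * (k + 1) : ℝ) * (2 * (k + 1) + d - 2)) /
        ((d : ℝ) - 1) ^ 2)

/-- The constants are nonnegative for `d ≥ 2`. -/
theorem localVarConst_nonneg {d : ℕ} (hd : 2 ≤ d) (Δ : ℕ) : ∀ k, 0 ≤ localVarConst d Δ k
  | 0 => by simp only [localVarConst]; positivity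
  | k + 1 => by
      have hd' : (2 : ℝ) ≤ d := by exact_mod_cast hd
      have h1 : (0 : ℝ) ≤ 2 * (k + 1) + d - 2 := by linarith
      simp only [localVarConst]
      exact mul_nonneg (localVarConst_nonneg hd Δ k) (by positivity)

variable [Fintype Λ] [DecidableEq Λ] [Nonempty Λ] [Nontrivial E] {U : Λ → Λ → (E →L[ℝ] E)}

omit [MeasurableSpace E] [BorelSpace E] [Nontrivial E] in
/-- The parts of `esLocalAction` are the `esPart`s. -/
theorem esLocalAction_part (hU0 : ∀ n, U n n = 0)
    (hUadj : ∀ m n (v w : E), ⟪U m n v, w⟫ = ⟪v, U n m w⟫) (κ S₀ : ℝ) :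
    (esLocalAction hU0 hUadj κ S₀).part = esPart κ S₀ U := rfl

omit [MeasurableSpace E] [BorelSpace E] [Nontrivial E] in
/-- The degree of `esLocalAction` is `2`. -/
theorem esLocalAction_deg (hU0 : ∀ n, U n n = 0)
    (hUadj : ∀ m n (v w : E), ⟪U m n v, w⟫ = ⟪v, U n m w⟫) (κ S₀ : ℝ) :
    (esLocalAction hU0 hUadj κ S₀).deg = 2 := rfl

omit [MeasurableSpace E] [BorelSpace E] [Nontrivial E] in
/-- The neighbourhood structure of `esLocalAction` is the coupling graph. -/
theorem esLocalAction_N (hU0 : ∀ n, U n n = 0)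
    (hUadj : ∀ m n (v w : E), ⟪U m n v, w⟫ = ⟪v, U n m w⟫) (κ S₀ : ℝ) :
    (esLocalAction hU0 hUadj κ S₀).N = couplingNbhd U := rfl

omit [Nontrivial E] in
/-- **The footprint and degree of the E–S local terms, with the numerals in place**:
`X_n⁽ᵏ⁾ ∈ polySD (2(k+1)) (nball (couplingNbhd U) (k+1) n)`. -/
theorem localTerm_mem_es (h2 : 2 ≤ Module.finrank ℝ E) (hU0 : ∀ n, U n n = 0)
    (hUadj : ∀ m n (v w : E), ⟪U m n v, w⟫ = ⟪v, U n m w⟫) (κ S₀ : ℝ) (k : ℕ) (n : Λ) :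
    localTerm h2 (esLocalAction hU0 hUadj κ S₀) k n ∈
      polySD Λ E (2 * (k + 1)) (nball (couplingNbhd U) (k + 1) n) := by
  have h := localTerm_mem h2 (esLocalAction hU0 hUadj κ S₀) k n
  rw [esLocalAction_deg, esLocalAction_N] at h
  exact h

omit [Nontrivial E] in
/-- The local terms of the E–S action, read on the product of spheres, are continuous. -/
theorem continuous_localTerm_sphereConfig (h2 : 2 ≤ Module.finrank ℝ E) (hU0 : ∀ n, U n n = 0)
    (hUadj : ∀ m n (v w : E), ⟪U m n v, w⟫ = ⟪v, U n m w⟫) (κ S₀ : ℝ) (k : ℕ) (n : Λ) :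
    Continuous fun ω : Λ → sphere (0 : E) 1 =>
      localTerm h2 (esLocalAction hU0 hUadj κ S₀) k n (fun m => (ω m : E)) :=
  (contDiff_of_mem_polyS (localTerm_mem_es h2 hU0 hUadj κ S₀ k n).1).continuous.comp
    continuous_sphereConfig

/-- **Order `0`: `Var(X_n⁽⁰⁾) ≤ (κυ)²/(d−1)²`.**  The order-`0` local term solves
`−Σ∂̃² X = s_n + c` with `s_n = −κ⟪x_n, J_n⟫ + S₀/|Λ|`, whose fluctuation is at most `|κ|υ`. -/
theorem variance_localTerm_zero_le (h2 : 2 ≤ Module.finrank ℝ E) (hU0 : ∀ n, U n n = 0)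
    (hUadj : ∀ m n (v w : E), ⟪U m n v, w⟫ = ⟪v, U n m w⟫) (κ S₀ : ℝ) {υ : ℝ}
    (hυ : ∀ k, ∑ m, ‖U k m‖ ≤ υ) (n : Λ) :
    ∫ ω, (localTerm h2 (esLocalAction hU0 hUadj κ S₀) 0 n (fun m => ((ω : Λ → sphere (0 : E) 1) m : E)) -
        ∫ ω', localTerm h2 (esLocalAction hU0 hUadj κ S₀) 0 n
          (fun m => ((ω' : Λ → sphere (0 : E) 1) m : E))
          ∂Measure.pi (fun _ : Λ => uniformSphere (volume : Measure E))) ^ 2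
        ∂Measure.pi (fun _ : Λ => uniformSphere (volume : Measure E)) ≤
      (κ * υ) ^ 2 / (((Module.finrank ℝ E : ℝ) - 1) ^ 2) := by
  set μ : Measure (sphere (0 : E) 1) := uniformSphere (volume : Measure E) with hμ
  set D := esLocalAction hU0 hUadj κ S₀ with hD
  obtain ⟨c, hc⟩ := localTerm_zero_spec h2 D n
  have hstab := polyS_recursion_stable (Λ := Λ) (R := D.part n) h2 (localTerm_mem h2 D 0 n).1 hc
  have hd : (0 : ℝ) < (Module.finrank ℝ E : ℝ) - 1 := by
    have : (2 : ℝ) ≤ Module.finrank ℝ E := by exact_mod_cast h2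
    linarith
  -- the fluctuation of the part `s_n` is at most `|κ| υ`
  have hpart : ∀ ω : Λ → sphere (0 : E) 1,
      (D.part n (fun m => (ω m : E)) - S₀ / Fintype.card Λ) ^ 2 ≤ (κ * υ) ^ 2 := fun ω => by
    have hx : ∀ m, ‖((ω m : sphere (0 : E) 1) : E)‖ = 1 := fun m => by simp
    have e : D.part n (fun m => (ω m : E)) - S₀ / Fintype.card Λ =
        -κ * ⟪((ω n : sphere (0 : E) 1) : E), localField U n (fun m => (ω m : E))⟫ := by
      rw [hD, esLocalAction_part]; simp only [esPart]; ring
    have hin : |⟪((ω n : sphere (0 : E) 1) : E), localField U n (fun m => (ω m : E))⟫| ≤ υ :=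
      (abs_real_inner_le_norm _ _).trans (by
        rw [hx n, one_mul]; exact norm_localField_le hυ hx n)
    rw [e]
    calc (-κ * ⟪((ω n : sphere (0 : E) 1) : E), localField U n (fun m => (ω m : E))⟫) ^ 2
        = κ ^ 2 * |⟪((ω n : sphere (0 : E) 1) : E), localField U n (fun m => (ω m : E))⟫| ^ 2 := by
          rw [mul_pow, neg_sq, sq_abs]
      _ ≤ κ ^ 2 * υ ^ 2 := by gcongr
      _ = (κ * υ) ^ 2 := by ring
  have hpc : Continuous fun ω : Λ → sphere (0 : E) 1 => D.part n (fun m => (ω m : E)) :=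
    (contDiff_of_mem_polyS (D.part_mem n).1).continuous.comp continuous_sphereConfig
  have hVR : ∫ ω, (D.part n (fun m => ((ω : Λ → sphere (0 : E) 1) m : E)) -
      ∫ ω', D.part n (fun m => ((ω' : Λ → sphere (0 : E) 1) m : E)) ∂Measure.pi (fun _ : Λ => μ)) ^ 2
        ∂Measure.pi (fun _ : Λ => μ) ≤ (κ * υ) ^ 2 := by
    calc _ ≤ ∫ ω, (D.part n (fun m => ((ω : Λ → sphere (0 : E) 1) m : E)) - S₀ / Fintype.card Λ) ^ 2
          ∂Measure.pi (fun _ : Λ => μ) := variance_le_integral_sub_const_sq hpc _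
      _ ≤ ∫ _, (κ * υ) ^ 2 ∂Measure.pi (fun _ : Λ => μ) :=
          integral_mono (integrable_pi_of_continuous μ ((hpc.sub continuous_const).pow 2))
            (integrable_const _) hpart
      _ = (κ * υ) ^ 2 := by
          rw [integral_const, smul_eq_mul, Measure.real, measure_univ, ENNReal.toReal_one, one_mul]
  rw [le_div_iff₀ (pow_pos hd 2), mul_comm]
  exact hstab.trans hVR

omit [Nontrivial E] in
/-- The local terms' site gradients vanish outside the coupling ball of radius `k+1`. -/
theorem siteGrad_localTerm_eq_zero (h2 : 2 ≤ Module.finrank ℝ E) (hU0 : ∀ n, U n n = 0)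
    (hUadj : ∀ m n (v w : E), ⟪U m n v, w⟫ = ⟪v, U n m w⟫) (κ S₀ : ℝ) (k : ℕ) (n : Λ) {j : Λ}
    (hj : j ∉ nball (couplingNbhd U) (k + 1) n) (x : Λ → E) :
    siteGrad j (localTerm h2 (esLocalAction hU0 hUadj κ S₀) k n) x = 0 :=
  siteGrad_eq_zero_of_not_mem' (localTerm_mem_es h2 hU0 hUadj κ S₀ k n).2 hj x

/-- **One step of the chain**: `Var(X_n⁽ᵏ⁺¹⁾) ≤ 4(κυ)²(Δ+1)^{k+1}·2(k+1)(2(k+1)+d−2)/(d−1)² ·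
Var(X_n⁽ᵏ⁾)` — stability of the Poisson step, pointwise Cauchy–Schwarz over the `≤ (Δ+1)^{k+1}`
sites of the footprint, the force bound `‖∂̃S‖ ≤ 2|κ|υ`, and Bernstein at degree `2(k+1)`. -/
theorem variance_localTerm_succ_le (h2 : 2 ≤ Module.finrank ℝ E) (hU0 : ∀ n, U n n = 0)
    (hUadj : ∀ m n (v w : E), ⟪U m n v, w⟫ = ⟪v, U n m w⟫) (κ S₀ : ℝ) {υ : ℝ}
    (hυ : ∀ k, ∑ m, ‖U k m‖ ≤ υ) {Δ : ℕ} (hΔ : ∀ m, (couplingNbhd U m).ncard ≤ Δ) (k : ℕ) (n : Λ) :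
    ∫ ω, (localTerm h2 (esLocalAction hU0 hUadj κ S₀) (k + 1) n
          (fun m => ((ω : Λ → sphere (0 : E) 1) m : E)) -
        ∫ ω', localTerm h2 (esLocalAction hU0 hUadj κ S₀) (k + 1) n
          (fun m => ((ω' : Λ → sphere (0 : E) 1) m : E))
          ∂Measure.pi (fun _ : Λ => uniformSphere (volume : Measure E))) ^ 2
        ∂Measure.pi (fun _ : Λ => uniformSphere (volume : Measure E)) ≤
      (4 * (κ * υ) ^ 2 * ((Δ : ℝ) + 1) ^ (k + 1) * ((2 * (k + 1) : ℝ) * (2 * (k + 1) +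
        (Module.finrank ℝ E : ℝ) - 2)) / ((Module.finrank ℝ E : ℝ) - 1) ^ 2) *
      ∫ ω, (localTerm h2 (esLocalAction hU0 hUadj κ S₀) k n
          (fun m => ((ω : Λ → sphere (0 : E) 1) m : E)) -
        ∫ ω', localTerm h2 (esLocalAction hU0 hUadj κ S₀) k n
          (fun m => ((ω' : Λ → sphere (0 : E) 1) m : E))
          ∂Measure.pi (fun _ : Λ => uniformSphere (volume : Measure E))) ^ 2
        ∂Measure.pi (fun _ : Λ => uniformSphere (volume : Measure E)) := by
  set μ : Measure (sphere (0 : E) 1) := uniformSphere (volume : Measure E) with hμ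
  set D := esLocalAction hU0 hUadj κ S₀ with hD
  set X := localTerm h2 D k n with hXdef
  set X' := localTerm h2 D (k + 1) n with hX'def
  have hd : (0 : ℝ) < (Module.finrank ℝ E : ℝ) - 1 := by
    have : (2 : ℝ) ≤ Module.finrank ℝ E := by exact_mod_cast h2
    linarith
  have hXm : X ∈ polySD Λ E (2 * (k + 1)) (nball (couplingNbhd U) (k + 1) n) :=
    localTerm_mem_es h2 hU0 hUadj κ S₀ k n
  have hXinf := contDiff_of_mem_polyS hXm.1
  have hact : D.action = esAction κ S₀ U := esLocalAction_action hU0 hUadj κ S₀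
  have hSinf := contDiff_of_mem_polyS D.action_mem
  -- (1) stability of the Poisson step
  obtain ⟨c, hc⟩ := localTerm_succ_spec h2 D k n
  have hstab := polyS_recursion_stable (Λ := Λ) (R := fun x => -latticeCarre D.action X x) h2
    (localTerm_mem h2 D (k + 1) n).1 hc
  -- (2) the source on the spheres is `−Σ_j ⟪∂̃_j S, ∂̃_j X⟫`, continuous; its variance ≤ ∫ source²
  have hRm : (fun x => -latticeCarre D.action X x) ∈ polyS Λ E (D.deg + 2 * (k + 1)) :=
    (D.source_mem hXm).1
  have hRc : Continuous fun ω : Λ → sphere (0 : E) 1 => -latticeCarre D.action X (fun m => (ω m : E)) :=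
    (contDiff_of_mem_polyS hRm).continuous.comp continuous_sphereConfig
  have hRsq : ∀ ω : Λ → sphere (0 : E) 1,
      (-latticeCarre D.action X (fun m => (ω m : E)) - 0) ^ 2 =
        (∑ j, ⟪siteGrad j D.action (fun m => (ω m : E)), siteGrad j X (fun m => (ω m : E))⟫) ^ 2 :=
    fun ω => by
      rw [sub_zero, neg_sq, ← sum_inner_siteGrad_eq_latticeCarre hSinf hXinf fun j => by simp]
  have hVR := variance_le_integral_sub_const_sq (Λ := Λ) hRc 0
  simp_rw [hRsq] at hVR
  -- (3) the integrated source bound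
  classical
  set B : Finset Λ := (toFinite (nball (couplingNbhd U) (k + 1) n)).toFinset with hB
  have hXB : ∀ j ∉ B, ∀ x, siteGrad j X x = 0 := fun j hj x =>
    siteGrad_eq_zero_of_not_mem' hXm.2 (fun h => hj ((Finite.mem_toFinset _).2 h)) x
  have hBcard : (B.card : ℝ) ≤ ((Δ : ℝ) + 1) ^ (k + 1) := by
    have h1 : B.card ≤ (Δ + 1) ^ (k + 1) := by
      rw [hB, ← Set.ncard_eq_toFinset_card _ (toFinite _)]
      exact ncard_nball_le hΔ n (k + 1)
    exact_mod_cast h1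
  have hS1 : ContDiff ℝ 1 D.action := contDiff_infty.1 hSinf 1
  have hSle : ∀ ω : Λ → sphere (0 : E) 1, ∀ j,
      ‖siteGrad j D.action (fun m => (ω m : E))‖ ≤ 2 * |κ| * υ := fun ω j => by
    rw [hact]
    exact norm_siteGrad_esAction_le hU0 hUadj κ S₀ hυ (fun m => by simp) j
  have hsrc := integral_sq_source_le (Λ := Λ) hXm.1 hXB hS1 hSle
  -- (4) assemble
  have hV0 : 0 ≤ ∫ ω, (X (fun m => ((ω : Λ → sphere (0 : E) 1) m : E)) -
      ∫ ω', X (fun m => ((ω' : Λ → sphere (0 : E) 1) m : E)) ∂Measure.pi (fun _ : Λ => μ)) ^ 2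
        ∂Measure.pi (fun _ : Λ => μ) := integral_nonneg fun ω => sq_nonneg _
  have hMM : (0 : ℝ) ≤ ((2 * (k + 1) : ℕ) : ℝ) * ((2 * (k + 1) : ℕ) + (Module.finrank ℝ E : ℝ) - 2) := by
    apply mul_nonneg (Nat.cast_nonneg _)
    push_cast; linarith
  have hchain : ((Module.finrank ℝ E : ℝ) - 1) ^ 2 *
      ∫ ω, (X' (fun m => ((ω : Λ → sphere (0 : E) 1) m : E)) -
        ∫ ω', X' (fun m => ((ω' : Λ → sphere (0 : E) 1) m : E)) ∂Measure.pi (fun _ : Λ => μ)) ^ 2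
          ∂Measure.pi (fun _ : Λ => μ) ≤
      (2 * |κ| * υ) ^ 2 * ((Δ : ℝ) + 1) ^ (k + 1) *
        (((2 * (k + 1) : ℕ) : ℝ) * ((2 * (k + 1) : ℕ) + (Module.finrank ℝ E : ℝ) - 2)) *
        ∫ ω, (X (fun m => ((ω : Λ → sphere (0 : E) 1) m : E)) -
          ∫ ω', X (fun m => ((ω' : Λ → sphere (0 : E) 1) m : E)) ∂Measure.pi (fun _ : Λ => μ)) ^ 2
            ∂Measure.pi (fun _ : Λ => μ) := by
    refine (hstab.trans (hVR.trans hsrc)).trans ?_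
    have h4 : 0 ≤ (2 * |κ| * υ) ^ 2 := sq_nonneg _
    gcongr
  have e1 : (2 * |κ| * υ) ^ 2 = 4 * (κ * υ) ^ 2 := by rw [mul_pow, mul_pow, sq_abs]; ring
  have e2 : (((2 * (k + 1) : ℕ) : ℝ) * ((2 * (k + 1) : ℕ) + (Module.finrank ℝ E : ℝ) - 2)) =
      ((2 * (k + 1) : ℝ) * (2 * (k + 1) + (Module.finrank ℝ E : ℝ) - 2)) := by push_cast; ring
  rw [e1, e2] at hchain
  rw [div_mul_eq_mul_div, le_div_iff₀ (pow_pos hd 2), mul_comm]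
  exact hchain

/-- **VOLUME-INDEPENDENT `L²(π̄)` BOUNDS ON THE LOCAL TERMS OF LÜSCHER'S SERIES.**  For the lattice
CP(N−1)/O(N) action with couplings of weight `Σ_m‖U_{km}‖ ≤ υ` and at most `Δ` partners per site
(no self-coupling, adjoint pairs; `d = dim E ≥ 2`), the order-`k` local term anchored at any site
`n` satisfies `Var_π̄(X_n⁽ᵏ⁾) ≤ (κυ)^{2(k+1)} · A_k(d, Δ)` for EVERY finite lattice `Λ` — the bound
depends on the order, the target dimension, the coordination number and the coupling only. -/
theorem variance_localTerm_le (h2 : 2 ≤ Module.finrank ℝ E) (hU0 : ∀ n, U n n = 0)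
    (hUadj : ∀ m n (v w : E), ⟪U m n v, w⟫ = ⟪v, U n m w⟫) (κ S₀ : ℝ) {υ : ℝ}
    (hυ : ∀ k, ∑ m, ‖U k m‖ ≤ υ) {Δ : ℕ} (hΔ : ∀ m, (couplingNbhd U m).ncard ≤ Δ) (k : ℕ) (n : Λ) :
    ∫ ω, (localTerm h2 (esLocalAction hU0 hUadj κ S₀) k n
          (fun m => ((ω : Λ → sphere (0 : E) 1) m : E)) -
        ∫ ω', localTerm h2 (esLocalAction hU0 hUadj κ S₀) k n
          (fun m => ((ω' : Λ → sphere (0 : E) 1) m : E))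
          ∂Measure.pi (fun _ : Λ => uniformSphere (volume : Measure E))) ^ 2
        ∂Measure.pi (fun _ : Λ => uniformSphere (volume : Measure E)) ≤
      (κ * υ) ^ (2 * (k + 1)) * localVarConst (Module.finrank ℝ E) Δ k := by
  have hd : (0 : ℝ) < (Module.finrank ℝ E : ℝ) - 1 := by
    have : (2 : ℝ) ≤ Module.finrank ℝ E := by exact_mod_cast h2
    linarith
  induction k with
  | zero =>
      have h := variance_localTerm_zero_le (Λ := Λ) h2 hU0 hUadj κ S₀ hυ n
      simpa only [localVarConst, div_eq_mul_inv, zero_add, mul_one] using h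
  | succ k ih =>
      have hstep := variance_localTerm_succ_le (Λ := Λ) h2 hU0 hUadj κ S₀ hυ hΔ k n
      have hpos : (0 : ℝ) ≤ 2 * (k + 1) + (Module.finrank ℝ E : ℝ) - 2 := by linarith
      have hfac : 0 ≤ 4 * (κ * υ) ^ 2 * ((Δ : ℝ) + 1) ^ (k + 1) * ((2 * (k + 1) : ℝ) *
          (2 * (k + 1) + (Module.finrank ℝ E : ℝ) - 2)) / ((Module.finrank ℝ E : ℝ) - 1) ^ 2 :=
        div_nonneg (mul_nonneg (by positivity) (mul_nonneg (by positivity) hpos)) (sq_nonneg _)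
      refine hstep.trans ((mul_le_mul_of_nonneg_left ih hfac).trans (le_of_eq ?_))
      simp only [localVarConst]
      ring

/-- **The Dirichlet (generator) form**: `Σ_m ∫‖∂̃_m X_n⁽ᵏ⁾‖² dπ̄ ≤ 2(k+1)(2(k+1)+d−2)·(κυ)^{2(k+1)}·A_k`
— the `L²(π̄)` size of the order-`k` local GENERATOR `−∂̃X_n⁽ᵏ⁾` (the vector field entering the
perturbative trivializing map) is bounded independently of the volume as well. -/
theorem dirichlet_localTerm_le (h2 : 2 ≤ Module.finrank ℝ E) (hU0 : ∀ n, U n n = 0)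
    (hUadj : ∀ m n (v w : E), ⟪U m n v, w⟫ = ⟪v, U n m w⟫) (κ S₀ : ℝ) {υ : ℝ}
    (hυ : ∀ k, ∑ m, ‖U k m‖ ≤ υ) {Δ : ℕ} (hΔ : ∀ m, (couplingNbhd U m).ncard ≤ Δ) (k : ℕ) (n : Λ) :
    ∑ j, ∫ ω, ‖siteGrad j (localTerm h2 (esLocalAction hU0 hUadj κ S₀) k n)
        (fun m => ((ω : Λ → sphere (0 : E) 1) m : E))‖ ^ 2
        ∂Measure.pi (fun _ : Λ => uniformSphere (volume : Measure E)) ≤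
      ((2 * (k + 1) : ℝ) * (2 * (k + 1) + (Module.finrank ℝ E : ℝ) - 2)) *
        ((κ * υ) ^ (2 * (k + 1)) * localVarConst (Module.finrank ℝ E) Δ k) := by
  have hXm := localTerm_mem_es h2 hU0 hUadj κ S₀ k n
  have hB := bernstein_polyS_uniform (Λ := Λ) (2 * (k + 1)) hXm.1
    (∫ ω', localTerm h2 (esLocalAction hU0 hUadj κ S₀) k n
      (fun m => ((ω' : Λ → sphere (0 : E) 1) m : E))
      ∂Measure.pi (fun _ : Λ => uniformSphere (volume : Measure E)))
  have hpos : (0 : ℝ) ≤ (2 * (k + 1) : ℝ) * (2 * (k + 1) + (Module.finrank ℝ E : ℝ) - 2) := by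
    have : (2 : ℝ) ≤ Module.finrank ℝ E := by exact_mod_cast h2
    apply mul_nonneg (by positivity); linarith
  have e : (((2 * (k + 1) : ℕ) : ℝ) * ((2 * (k + 1) : ℕ) + (Module.finrank ℝ E : ℝ) - 2)) =
      ((2 * (k + 1) : ℝ) * (2 * (k + 1) + (Module.finrank ℝ E : ℝ) - 2)) := by push_cast; ring
  rw [e] at hB
  exact hB.trans (mul_le_mul_of_nonneg_left
    (variance_localTerm_le h2 hU0 hUadj κ S₀ hυ hΔ k n) hpos)

end Recursion

end Summit.Ventures.LatticeQCDFlow.Exactness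

end
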